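import Mathlib
import Literature.AlgebraicGeometry.Resolution.InitialFormsChangeOfParameters
import Literature.AlgebraicGeometry.Resolution.NearPointTauMonotone
import HarnessLib

/-!
# Adapted regular systems of parameters: shifts and `𝔪²`-perturbations

Topic: `Literature/AlgebraicGeometry/Resolution`. Coordinate bookkeeping for following a chain of
near points with `τ = 2` in the termination proof of Cossart–Piltant 2008, Prop. 4.4 (p. 11; cf.
proof of Lemma 4.3 (3): "we choose `(y₁, y₂, y₃)` in such a way that `T_x = <Y₂, Y₃>`"). A
regular system of parameters `c` of the regular local ring `R` is ADAPTED to the index `j` (for the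
ideal `J` at order `μ`) if `e_j ∈ 𝕎(cl_μ^{c} J)`, i.e. every form of the directrix kills `e_j`
(`T_x ⊆ <Y_i : i ≠ j>`). PROVED, on top of `initialForms_eq_image_linSubst`
(`InitialFormsChangeOfParameters.lean`) and `invarianceSpace_image_linSubst`
(`HironakaDirectrixLinear.lean`):

* `initialForms_eq_of_sub_mem_sq` — **`cl_μ` does not change under `c ↦ c + 𝔪²`** (the
  transition matrix reduces to `1` by Matsumura 17.10); hence `IsAdapted` is stable
  (`IsAdapted.of_sub_mem_sq`) and the perturbed family is again a regular system of parameters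
  (`span_range_eq_of_sub_mem_sq`);
* `isAdapted_shiftRsop` — **re-adapting by a shift**: if the vector `v` with `v_j = 1`,
  `v_i = ā_i` lies in `𝕎(cl_μ^{c} J)` then the shifted system `c̃_i = c_i − a_i c_j` is adapted;
* `exists_isAdapted_of_finrank_invarianceSpace_pos` — an adapted system exists as soon as
  `𝕎 ≠ 0` (e.g. `τ = d − 1`).

## Sources

* V. Cossart, O. Piltant, J. Algebra 320 (2008), proof of Prop. 4.2 and of Lemma 4.3 (3). [CossartPiltant2008]
* H. Matsumura, *Commutative Ring Theory* (1986), Thm. 17.10. [Matsumura1987]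
-/

noncomputable section

open IsLocalRing MvPolynomial

namespace Literature.AlgebraicGeometry.Resolution

universe u

variable {R : Type u} [CommRing R]

/-- **Adapted coordinates**: `e_j` lies in the invariance space of `cl_μ^{c}(J)` (every form of
the directrix `T` kills `e_j`, i.e. `T ⊆ <Y_i : i ≠ j>`). [cite: CossartPiltant2008, proof of Lemma 4.3 (3)] -/
def IsAdapted [IsLocalRing R] {d : ℕ} (c : Fin d → R) (J : Ideal R) (μ : ℕ) (j : Fin d) : Prop :=
  (Pi.single j 1 : Fin d → ResidueField R) ∈
    invarianceSpace (ResidueField R) (initialForms c J μ : Set (MvPolynomial (Fin d) (ResidueField R)))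

/-- Adaptedness in terms of the directrix: every `ℓ ∈ T` kills `e_j`. [folklore] -/
theorem IsAdapted.apply_single_eq_zero [IsLocalRing R] {d : ℕ} {c : Fin d → R} {J : Ideal R}
    {μ : ℕ} {j : Fin d} (h : IsAdapted c J μ j) {ℓ : Module.Dual (ResidueField R) (Fin d → ResidueField R)}
    (hℓ : ℓ ∈ directrix (ResidueField R)
      (initialForms c J μ : Set (MvPolynomial (Fin d) (ResidueField R)))) :
    ℓ (Pi.single j 1) = 0 :=
  (mem_directrix_iff (ResidueField R)).mp hℓ _ h

/-- Conversely (over the residue FIELD, `𝕎 = T^⊥`). [folklore] -/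
theorem isAdapted_of_forall_directrix [IsLocalRing R] {d : ℕ} {c : Fin d → R} {J : Ideal R}
    {μ : ℕ} {j : Fin d}
    (h : ∀ ℓ ∈ directrix (ResidueField R)
      (initialForms c J μ : Set (MvPolynomial (Fin d) (ResidueField R))), ℓ (Pi.single j 1) = 0) :
    IsAdapted c J μ j := by
  unfold IsAdapted
  have hW : invarianceSpace (ResidueField R)
      (initialForms c J μ : Set (MvPolynomial (Fin d) (ResidueField R))) =
      (directrix (ResidueField R)
        (initialForms c J μ : Set (MvPolynomial (Fin d) (ResidueField R)))).dualCoannihilator :=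
    (Subspace.dualAnnihilator_dualCoannihilator_eq).symm
  rw [hW, Submodule.mem_dualCoannihilator]
  exact h

section Regular

variable [IsRegularLocalRing R] {d : ℕ} (hd : (maximalIdeal R).spanFinrank = d)
  {c : Fin d → R} (hc : Ideal.span (Set.range c) = maximalIdeal R)

/-! ## `𝔪²`-perturbations -/

include hc in
/-- A family congruent to `c` modulo `𝔪²` generates `𝔪` (Nakayama). [folklore] -/
theorem span_range_eq_of_sub_mem_sq {c₂ : Fin d → R} (h : ∀ i, c₂ i - c i ∈ maximalIdeal R ^ 2) :
    Ideal.span (Set.range c₂) = maximalIdeal R := by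
  haveI : IsNoetherianRing R := inferInstance
  apply le_antisymm
  · rw [Ideal.span_le]
    rintro _ ⟨i, rfl⟩
    have : c₂ i = (c₂ i - c i) + c i := by ring
    rw [SetLike.mem_coe, this]
    exact Ideal.add_mem _ (Ideal.pow_le_self two_ne_zero (h i)) (hc ▸ Ideal.subset_span ⟨i, rfl⟩)
  · refine Submodule.le_of_le_smul_of_le_jacobson_bot (maximalIdeal R).fg_of_isNoetherianRing
      (IsLocalRing.maximalIdeal_le_jacobson _) ?_
    rw [Ideal.smul_eq_mul, ← sq]
    conv_lhs => rw [← hc]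
    rw [Ideal.span_le]
    rintro _ ⟨i, rfl⟩
    have : c i = c₂ i - (c₂ i - c i) := by ring
    rw [SetLike.mem_coe, this]
    exact Ideal.sub_mem _ (Ideal.mem_sup_left (Ideal.subset_span ⟨i, rfl⟩)) (Ideal.mem_sup_right (h i))

include hd hc in
/-- **`cl_μ^{c}(J)` is unchanged under `c ↦ c + 𝔪²`**: the transition matrix `a` with
`c₂ = a c` reduces to the identity (a linear form in `c` with value in `𝔪²` has coefficients in
`𝔪`, Matsumura 17.10). [cite: CossartPiltant2008, proof of Prop. 4.2] [cite: Matsumura1987, Thm. 17.10] -/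
theorem initialForms_eq_of_sub_mem_sq {c₂ : Fin d → R} (h : ∀ i, c₂ i - c i ∈ maximalIdeal R ^ 2)
    (J : Ideal R) (μ : ℕ) : initialForms c₂ J μ = initialForms c J μ := by
  classical
  have hc₂ := span_range_eq_of_sub_mem_sq hc h
  obtain ⟨a, ha⟩ := exists_matrix_rsop_eq c₂ c (by rw [hc, hc₂])
  obtain ⟨b, hb⟩ := exists_matrix_rsop_eq c c₂ (by rw [hc, hc₂])
  -- `ā = 1`
  have hā : a.map (residue R) = 1 := by
    ext i m
    set F : MvPolynomial (Fin d) R := ∑ m', C (a i m' - (1 : Matrix (Fin d) (Fin d) R) i m') * X m'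
      with hFdef
    have hF : F.IsHomogeneous 1 :=
      IsHomogeneous.sum _ _ _ fun m' _ => (isHomogeneous_X R m').C_mul _
    have hFc : eval c F ∈ maximalIdeal R ^ (1 + 1) := by
      have h1 : eval c F = ∑ m', a i m' * c m' - ∑ m', (1 : Matrix (Fin d) (Fin d) R) i m' * c m' := by
        rw [hFdef, map_sum]
        simp only [map_mul, eval_C, eval_X, sub_mul, Finset.sum_sub_distrib]
      have h2 : ∑ m', (1 : Matrix (Fin d) (Fin d) R) i m' * c m' = c i := by
        rw [Finset.sum_eq_single i, Matrix.one_apply_eq, one_mul]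
        · intro m' _ hm'
          rw [Matrix.one_apply_ne (Ne.symm hm'), zero_mul]
        · exact fun h' => (h' (Finset.mem_univ i)).elim
      rw [h1, h2, ← ha i]
      exact h i
    have hcoeff := coeff_mem_maximalIdeal_of_eval_mem_pow hd c hc hF hFc (Finsupp.single m 1)
    have hcm : F.coeff (Finsupp.single m 1) = a i m - (1 : Matrix (Fin d) (Fin d) R) i m := by
      rw [hFdef, coeff_sum, Finset.sum_eq_single m]
      · rw [coeff_C_mul, coeff_X, if_pos rfl, mul_one]
      · intro m' _ hm'
        rw [coeff_C_mul, coeff_X, if_neg (fun h' => hm' (Finsupp.single_left_injective one_ne_zero h')),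
          mul_zero]
      · exact fun h' => (h' (Finset.mem_univ m)).elim
    rw [hcm, ← residue_eq_zero_iff, map_sub, sub_eq_zero] at hcoeff
    rw [Matrix.map_apply, hcoeff, Matrix.one_apply, Matrix.one_apply]
    split_ifs
    · exact map_one _
    · exact map_zero _
  -- `cl^{c} = σ_ā(cl^{c₂}) = cl^{c₂}`
  have key := initialForms_eq_image_linSubst hd hc ha hb J μ
  rw [hā, linSubst_one] at key
  apply le_antisymm
  · intro G hG
    have : G ∈ (initialForms c J μ : Set (MvPolynomial (Fin d) (ResidueField R))) := by
      rw [key]; exact ⟨G, hG, rfl⟩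
    exact this
  · intro G hG
    have hG' : G ∈ (initialForms c J μ : Set (MvPolynomial (Fin d) (ResidueField R))) := hG
    rw [key] at hG'
    obtain ⟨G', hG', rfl⟩ := hG'
    exact hG'

include hd hc in
/-- Adaptedness is stable under `c ↦ c + 𝔪²`. [folklore] -/
theorem IsAdapted.of_sub_mem_sq {J : Ideal R} {μ : ℕ} {j : Fin d} (had : IsAdapted c J μ j)
    {c₂ : Fin d → R} (h : ∀ i, c₂ i - c i ∈ maximalIdeal R ^ 2) : IsAdapted c₂ J μ j := by
  unfold IsAdapted at had ⊢
  rwa [initialForms_eq_of_sub_mem_sq hd hc h J μ]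

/-! ## Re-adapting by a shift -/

/-- The unipotent transition matrix `1 + E` of a shift, `E_{il} = a_i δ_{lj}` (`i ≠ j`). [folklore] -/
def shiftMatrix (j : Fin d) (a : {i : Fin d // i ≠ j} → R) : Matrix (Fin d) (Fin d) R :=
  Matrix.of fun i l => if h : i = j then 0 else if l = j then a ⟨i, h⟩ else 0

omit [IsRegularLocalRing R] in
/-- `c = (1 + E) c̃` for the shifted system `c̃ = shiftRsop c j a`. [folklore] -/
theorem eq_sum_one_add_shiftMatrix_mul (j : Fin d) (a : {i : Fin d // i ≠ j} → R) (i : Fin d) :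
    c i = ∑ l, (1 + shiftMatrix j a) i l * shiftRsop c j a l := by
  classical
  have hsplit : ∑ l, (1 + shiftMatrix j a) i l * shiftRsop c j a l =
      ∑ l, (1 : Matrix (Fin d) (Fin d) R) i l * shiftRsop c j a l +
        ∑ l, shiftMatrix j a i l * shiftRsop c j a l := by
    rw [← Finset.sum_add_distrib]
    exact Finset.sum_congr rfl fun l _ => by rw [Matrix.add_apply]; ring
  have h1 : ∑ l, (1 : Matrix (Fin d) (Fin d) R) i l * shiftRsop c j a l = shiftRsop c j a i := by
    rw [Finset.sum_eq_single i, Matrix.one_apply_eq, one_mul]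
    · intro l _ hl; rw [Matrix.one_apply_ne (Ne.symm hl), zero_mul]
    · exact fun h => (h (Finset.mem_univ i)).elim
  have h2 : ∑ l, shiftMatrix j a i l * shiftRsop c j a l =
      if h : i = j then 0 else a ⟨i, h⟩ * c j := by
    by_cases h : i = j
    · rw [dif_pos h]
      refine Finset.sum_eq_zero fun l _ => ?_
      simp [shiftMatrix, h]
    · rw [dif_neg h, Finset.sum_eq_single j]
      · simp [shiftMatrix, h, shiftRsop_self]
      · intro l _ hl; simp [shiftMatrix, h, hl]
      · exact fun h' => (h' (Finset.mem_univ j)).elim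
  rw [hsplit, h1, h2]
  by_cases h : i = j
  · subst h; rw [dif_pos rfl, shiftRsop_self, add_zero]
  · rw [dif_neg h, shiftRsop_of_ne c j a h]; ring

omit [IsRegularLocalRing R] in
/-- `c̃ = (1 − E) c`. [folklore] -/
theorem shiftRsop_eq_sum_one_sub_shiftMatrix_mul (j : Fin d) (a : {i : Fin d // i ≠ j} → R)
    (i : Fin d) : shiftRsop c j a i = ∑ l, (1 - shiftMatrix j a) i l * c l := by
  classical
  have hsplit : ∑ l, (1 - shiftMatrix j a) i l * c l =
      ∑ l, (1 : Matrix (Fin d) (Fin d) R) i l * c l - ∑ l, shiftMatrix j a i l * c l := by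
    rw [← Finset.sum_sub_distrib]
    exact Finset.sum_congr rfl fun l _ => by rw [Matrix.sub_apply]; ring
  have h1 : ∑ l, (1 : Matrix (Fin d) (Fin d) R) i l * c l = c i := by
    rw [Finset.sum_eq_single i, Matrix.one_apply_eq, one_mul]
    · intro l _ hl; rw [Matrix.one_apply_ne (Ne.symm hl), zero_mul]
    · exact fun h => (h (Finset.mem_univ i)).elim
  have h2 : ∑ l, shiftMatrix j a i l * c l = if h : i = j then 0 else a ⟨i, h⟩ * c j := by
    by_cases h : i = j
    · rw [dif_pos h]
      refine Finset.sum_eq_zero fun l _ => ?_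
      simp [shiftMatrix, h]
    · rw [dif_neg h, Finset.sum_eq_single j]
      · simp [shiftMatrix, h]
      · intro l _ hl; simp [shiftMatrix, h, hl]
      · exact fun h' => (h' (Finset.mem_univ j)).elim
  rw [hsplit, h1, h2]
  by_cases h : i = j
  · subst h; rw [dif_pos rfl, shiftRsop_self, sub_zero]
  · rw [dif_neg h, shiftRsop_of_ne c j a h]

/-- `(1 + Ē) e_j = v` with `v_j = 1`, `v_i = ā_i`. [folklore] -/
theorem one_add_shiftMatrix_mulVec_single (j : Fin d) (a : {i : Fin d // i ≠ j} → R) :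
    ((1 + shiftMatrix j a).map (residue R)).mulVec (Pi.single j 1) =
      fun i => if h : i = j then 1 else residue R (a ⟨i, h⟩) := by
  classical
  ext i
  rw [Matrix.mulVec_single_one, Matrix.col_apply, Matrix.map_apply, Matrix.add_apply]
  by_cases h : i = j
  · subst h; simp [shiftMatrix]
  · rw [dif_neg h, Matrix.one_apply_ne h, zero_add]
    simp [shiftMatrix, h]

include hd hc in
/-- **Re-adapting by a shift**: if the vector `v` with `v_j = 1`, `v_i = ā_i` (`i ≠ j`) lies in
`𝕎(cl_μ^{c} J)` (for `τ = d − 1`: `T = <Y_i + λ_i Y_j : i ≠ j>` and `ā_i = −λ_i`), then the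
shifted system `c̃_i = c_i − a_i c_j` is adapted: `e_j ∈ 𝕎(cl_μ^{c̃} J)`.
[cite: CossartPiltant2008, proof of Lemma 4.3 (3)] -/
theorem isAdapted_shiftRsop {J : Ideal R} {μ : ℕ} (j : Fin d) (a : {i : Fin d // i ≠ j} → R)
    (hv : (fun i => if h : i = j then (1 : ResidueField R) else residue R (a ⟨i, h⟩)) ∈
      invarianceSpace (ResidueField R)
        (initialForms c J μ : Set (MvPolynomial (Fin d) (ResidueField R)))) :
    IsAdapted (shiftRsop c j a) J μ j := by
  classical
  have hc₂ : Ideal.span (Set.range (shiftRsop c j a)) = maximalIdeal R := by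
    rw [span_range_shiftRsop, hc]
  -- `cl^{c̃} = σ_{(1+E)‾}(cl^{c})`
  have key := initialForms_eq_image_linSubst hd hc₂
    (eq_sum_one_add_shiftMatrix_mul (c := c) j a)
    (shiftRsop_eq_sum_one_sub_shiftMatrix_mul (c := c) j a) J μ
  have hAB := map_residue_transition_mul_eq_one hd hc
    (eq_sum_one_add_shiftMatrix_mul (c := c) j a)
    (shiftRsop_eq_sum_one_sub_shiftMatrix_mul (c := c) j a)
  unfold IsAdapted
  rw [key, invarianceSpace_image_linSubst (ResidueField R) hAB, Submodule.mem_comap,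
    Matrix.toLin'_apply, one_add_shiftMatrix_mulVec_single]
  exact hv

/-! ## Existence of adapted systems -/

include hd hc in
/-- **An adapted regular system of parameters exists as soon as `𝕎 ≠ 0`** (e.g. when
`τ = d − 1`): pick `0 ≠ w ∈ 𝕎`, an index `j` with `w_j ≠ 0`, and shift by `a_i = w_i / w_j`.
[cite: CossartPiltant2008, proof of Lemma 4.3 (3)] -/
theorem exists_isAdapted_of_ne_bot {J : Ideal R} {μ : ℕ}
    (hW : invarianceSpace (ResidueField R)
      (initialForms c J μ : Set (MvPolynomial (Fin d) (ResidueField R))) ≠ ⊥) :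
    ∃ (j : Fin d) (a : {i : Fin d // i ≠ j} → R), IsAdapted (shiftRsop c j a) J μ j := by
  classical
  obtain ⟨w, hw, hw0⟩ := Submodule.exists_mem_ne_zero_of_ne_bot hW
  obtain ⟨j, hj⟩ : ∃ j, w j ≠ 0 := by
    by_contra h
    push Not at h
    exact hw0 (funext h)
  -- normalise `w_j = 1` and lift the coordinates
  set w' : Fin d → ResidueField R := (w j)⁻¹ • w with hw'
  have hw'mem : w' ∈ invarianceSpace (ResidueField R)
      (initialForms c J μ : Set (MvPolynomial (Fin d) (ResidueField R))) :=
    Submodule.smul_mem _ _ hw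
  have hw'j : w' j = 1 := by simp [hw', hj]
  obtain ⟨a, ha⟩ : ∃ a : {i : Fin d // i ≠ j} → R, ∀ i, residue R (a i) = w' i.1 :=
    ⟨fun i => Classical.choose (residue_surjective (w' i.1)),
      fun i => Classical.choose_spec (residue_surjective (w' i.1))⟩
  refine ⟨j, a, isAdapted_shiftRsop hd hc j a ?_⟩
  convert hw'mem using 1
  funext i
  by_cases h : i = j
  · subst h; rw [dif_pos rfl, hw'j]
  · rw [dif_neg h, ha ⟨i, h⟩]

end Regular

end Literature.AlgebraicGeometry.Resolution

end
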